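import Summits.QuantumFields.YangMills.Theorems.FlatTubeReductionBORateBricksPot
import Summits.QuantumFields.YangMills.Theorems.FlatTubeReductionDressedSlowRatePot
import HarnessLib

/-!
# `BORateBricksPot → RateTube.SoftTubeBORatePackagePotOn` (given (EM)) and K1 ⇐ one instance of `BORateBricksPot` on the `β^{-1/6}` core + lane A's SHELL
# — the assembly of skeleton «ratepack-v3 / frozen fibres»
# (route `FlatTubeReduction`, crux K1 `NearFlatRatioLaw` stmt-QuantumFields-24720; seat `ym-line-ftr-p1` g12; R2b1 RECORD rung — no summit statement is proved here)

* ★★★ `softTubeBORatePackagePotOn_of_bricksPot` — `OneSiteEigenMoments → BORateBricksPot L χ δ → RateTube.SoftTubeBORatePackagePotOn L χ {orbitDist < δ}`: g10's assembly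
  (`softTubeBORatePackageOn_of_rateBricksD`, p657088) with (i) the off-diagonal clause run through the COLOUR AVERAGE of the slow coefficient (`tubeCross_colourAvg_left/right`,
  `colourAvg_boFunAd`) and the potential brick `hODpot`, giving SPLIT′ with `P a = κ_bγ∫_{orbitDist<δ₁} orbitDist²·G_a²`, and (ii) the SLOW′ clause from
  `slow_rate_clause_of_dressed_pot` fed with `hDSpot` (⟸ (EM), `dressedOneOrbitRatePot_of_eigenMoments`);
* ★★★ `coreRatePot_of_bricksPot` — CORE RATE at every level for the record core weight `recordChi L (1/6) 43 M` (`M ≥ 2`), test support `{orbitDist < β^{-1/6}}`;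
* ★★★★ `nearFlatRatioLaw_of_bricksPot_shell` — K1 `NearFlatRatioLaw` ⟸ (EM) [PROVED: `RateTube.oneSiteEigenMoments`] + (∀ L ≥ 2, one instance of `BORateBricksPot` on the core) +
  lane A's SHELL on `(β^{-1/6}, β^{-1/40})`.
HONEST FRAMING: assembly algebra; the analytic brick fields are OPEN fixed-lattice semiclassics on `SU(2)^{3L³}` (frozen fibres admissible; pooled with RED lane A's (B-T) pen);
femto rung R2b1 (RECORD label); not infinite volume, not a gap, not Clay.  No defs, no named facts, no `sorry`.
-/

set_option autoImplicit false

noncomputable section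

open MeasureTheory Filter Topology Real
open scoped BigOperators
open Literature.MathematicalPhysics.QuantumFieldTheory
open Literature.MathematicalPhysics.QuantumLattice

namespace Summit.QuantumFields.YangMills.Theorems.FemtoTransferGap.RateTube

open Summit.QuantumFields.YangMills.Theorems.FemtoTransferGap
open Summit.QuantumFields.YangMills.Theorems.FemtoTransferGap.TwoLattice.Avg
open Summit.QuantumFields.YangMills.Theorems.FemtoTransferGap.TwoLattice.ConstTube
open Summit.QuantumFields.YangMills.Theorems.FemtoTransferGap.TwoLattice.Stiff (LinkSpace)
open Summit.QuantumFields.YangMills.Theorems.FemtoCutoffLadder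

variable {L : ℕ} [NeZero L]

/-! ## §1 ★★★ The assembly -/

set_option maxHeartbeats 800000 in
/-- ★★★ **THE v3 PACKAGE FROM THE BRICK LIST WITH POTENTIAL, given (EM)**: `BORateBricksPot L χ δ → RateTube.SoftTubeBORatePackagePotOn L χ (fun β ↦ {U | orbitDist U < δ β})`.
Constant `C := max (max (48a_κ) (16a_b/θ₀)) (max (8|C_D|) (16·max C'' 1))`; MASS/STIFF/FLOOR as in p657088; SPLIT′ via the colour-averaged slow coefficient and `hODpot`; SLOW′ via
`slow_rate_clause_of_dressed_pot` and `hDSpot`. [cite: Luscher1983, §3] [cite: SjostrandZworski2007, §2] -/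
theorem softTubeBORatePackagePotOn_of_bricksPot (hEM : OneSiteEigenMoments) {χ : ℝ → GaugeConfig 3 L SU2 → ℝ} {δ : ℝ → ℝ} (K : BORateBricksPot L χ δ) :
    SoftTubeBORatePackagePotOn L χ (fun β => {U | orbitDist U < δ β}) := by
  intro k
  obtain ⟨hθ0, hθ1⟩ := K.hθ₀
  have hL1 : (1 : ℝ) ≤ (L : ℝ) ^ 3 := one_le_pow₀ (by exact_mod_cast NeZero.one_le)
  have hL3 : (0 : ℝ) < (L : ℝ) ^ 3 := by positivity
  -- crux ONE at `B = L³β`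
  obtain ⟨C1, B0, hONE⟩ := oneSiteLevels_proof k
  -- the DRESSED one-site no-intruder WITH POTENTIAL at level `k` (from (EM))
  obtain ⟨COS, hDSev⟩ := K.hDSpot hEM k
  -- the rate constants of the bricks
  obtain ⟨aκ, hκev⟩ := K.hκ_small
  obtain ⟨ab, hbev⟩ := K.hb_small
  obtain ⟨C'', hTopev⟩ := K.hTop
  -- the constant `C`
  set C : ℝ := max (max (48 * aκ) (16 * ab / K.θ₀)) (max (8 * |COS|) (16 * max C'' 1)) with hCdef
  have hC16 : 16 ≤ C := by
    have : (16 : ℝ) ≤ 16 * max C'' 1 := by nlinarith only [le_max_right C'' 1]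
    exact this.trans ((le_max_right _ _).trans (le_max_right _ _))
  have hC0 : 0 ≤ C := by linarith only [hC16]
  have hCκ : 48 * aκ ≤ C := (le_max_left _ _).trans (le_max_left _ _)
  have hCb : 16 * ab / K.θ₀ ≤ C := (le_max_right _ _).trans (le_max_left _ _)
  have hCOS : 8 * |COS| ≤ C := (le_max_left _ _).trans (le_max_right _ _)
  have hC'' : 16 * C'' ≤ C := by
    have : 16 * C'' ≤ 16 * max C'' 1 := by nlinarith only [le_max_left C'' 1]
    exact this.trans ((le_max_right _ _).trans (le_max_right _ _))
  refine ⟨C, K.θ₀, hC0, hθ0, hθ1, ?_⟩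
  set τ : ℝ := min (1 / (2 * (|levelGap k| + |C1| + 2))) (1 / (C + 1)) with hτ
  have hτ0 : 0 < τ := by rw [hτ]; exact lt_min (by positivity) (by positivity)
  obtain ⟨βc, hcross⟩ := crossBound_eventually_small_sq (L := L) (m := K.m) K.hm0 (ε := 1) one_pos
  have hκE : 0 ≤ 4 * K.κb / K.θ₀ := div_nonneg (by linarith [K.hκb]) hθ0.le
  -- collect everything eventually in `β`
  have hev : ∀ᶠ β : ℝ in atTop, ∃ σ b : ℝ, 0 < σ ∧ 0 ≤ b ∧ b ^ 2 ≤ C * bareLambda ((L : ℝ) ^ 3 * β) ^ 2 * K.θ₀ / 16 ∧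
      Real.exp (-(C * bareLambda ((L : ℝ) ^ 3 * β) ^ 2 / 4)) * (σ * levelValue su2Rep 1 ((L : ℝ) ^ 3 * β) 0) ≤ levelValue su2Rep L β 0 ∧
      ∀ f : Fin (k + 1) → (GaugeConfig 3 L SU2 → ℝ),
        (∀ i, Measurable (f i)) → (∀ i, ∃ C : ℝ, ∀ U, |f i U| ≤ C) → (∀ i U, f i U ≠ 0 → χ β U ≠ 0) → (∀ i U, f i U ≠ 0 → U ∈ {U : GaugeConfig 3 L SU2 | orbitDist U < δ β}) →
        (∀ a : Fin (k + 1) → ℝ, a ≠ 0 → 0 < tubeNormSq (softWeight (χ β)) (fun U => ∑ i, a i * f i U)) →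
          ∃ (u v : Fin (k + 1) → (GaugeConfig 3 L SU2 → ℝ)) (P : (Fin (k + 1) → ℝ) → ℝ),
            (∀ a : Fin (k + 1) → ℝ,
              0 ≤ P a ∧
              0 ≤ tubeNormSq (softWeight (χ β)) (fun U => ∑ i, a i * u i U) ∧
              0 ≤ tubeNormSq (softWeight (χ β)) (fun U => ∑ i, a i * v i U) ∧
              tubeNormSq (softWeight (χ β)) (fun U => ∑ i, a i * u i U) + tubeNormSq (softWeight (χ β)) (fun U => ∑ i, a i * v i U) ≤
                tubeNormSq (softWeight (χ β)) (fun U => ∑ i, a i * f i U) ∧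
              tubeForm β (fun U => ∑ i, a i * v i U) ≤
                (1 - K.θ₀) * (σ * levelValue su2Rep 1 ((L : ℝ) ^ 3 * β) 0) * tubeNormSq (softWeight (χ β)) (fun U => ∑ i, a i * v i U) ∧
              tubeForm β (fun U => ∑ i, a i * f i U) ≤
                tubeForm β (fun U => ∑ i, a i * u i U) +
                  2 * (σ * levelValue su2Rep 1 ((L : ℝ) ^ 3 * β) 0) *
                    Real.sqrt (b ^ 2 * tubeNormSq (softWeight (χ β)) (fun U => ∑ i, a i * u i U) + P a) *
                    Real.sqrt (tubeNormSq (softWeight (χ β)) (fun U => ∑ i, a i * v i U)) +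
                  tubeForm β (fun U => ∑ i, a i * v i U)) ∧
            ∃ a : Fin (k + 1) → ℝ, a ≠ 0 ∧
              tubeForm β (fun U => ∑ i, a i * u i U) + 4 / K.θ₀ * (σ * levelValue su2Rep 1 ((L : ℝ) ^ 3 * β) 0) * P a ≤
                Real.exp (C * bareLambda ((L : ℝ) ^ 3 * β) ^ 2 / 4) * (σ * levelValue su2Rep 1 ((L : ℝ) ^ 3 * β) k) *
                  tubeNormSq (softWeight (χ β)) (fun U => ∑ i, a i * u i U) := by
    filter_upwards [Filter.eventually_ge_atTop (max (max 1 B0) (max (max (1 : ℝ) 1) (max βc (2 / τ ^ 3)))),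
      hκev, hbev, hTopev, K.htube, K.hshadow, K.hbo, K.hδ₂, K.hN, K.hT, K.hST, K.hODpot, hDSev]
      with β hβ hκs hbs hTop htube hshadow hbo hδ₂ hN hT hST hOD hDS
    -- numbers
    have hβ1 : 1 ≤ β := ((le_max_left _ _).trans (le_max_left _ _)).trans hβ
    have hβ0 : 0 < β := by linarith only [hβ1]
    have hβB0 : B0 ≤ β := ((le_max_right _ _).trans (le_max_left _ _)).trans hβ
    have hβc : βc ≤ β := (((le_max_left _ _).trans (le_max_right _ _)).trans (le_max_right _ _)).trans hβ
    have hβτ : 2 / τ ^ 3 ≤ β := (((le_max_right _ _).trans (le_max_right _ _)).trans (le_max_right _ _)).trans hβ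
    set B : ℝ := (L : ℝ) ^ 3 * β with hBdef
    have hBβ : β ≤ B := by rw [hBdef]; nlinarith only [hL1, hβ0]
    have hB0 : 0 < B := lt_of_lt_of_le hβ0 hBβ
    set lam : ℝ := bareLambda B with hlamdef
    have hlam0 : 0 < lam := bareLambda_pos' hB0
    have hlamτ : lam ≤ τ := bareLambda_cube_le (L := L) hτ0 hβτ
    have hτle : τ ≤ 1 / (2 * (|levelGap k| + |C1| + 2)) := min_le_left _ _
    have hτC : τ ≤ 1 / (C + 1) := min_le_right _ _
    obtain ⟨-, -, hy⟩ := smallness_of_le hlam0.le (hlamτ.trans hτle)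
    have hlam1 : lam ≤ 1 := by
      have h22 : τ ≤ 1 / (2 * 2) := hτle.trans (by
        apply div_le_div_of_nonneg_left (by norm_num) (by norm_num)
        nlinarith only [abs_nonneg (levelGap k), abs_nonneg C1])
      linarith only [hlamτ, h22]
    obtain ⟨hμ0, -, hμk⟩ := hONE B (hβB0.trans hBβ)
    set μ0 : ℝ := levelValue su2Rep 1 B 0 with hμ0def
    set μk : ℝ := levelValue su2Rep 1 B k with hμkdef
    have hμk' : Real.exp (-(levelGap k * lam + |C1| * lam ^ 2)) * μ0 ≤ μk := by
      refine le_trans (mul_le_mul_of_nonneg_right (Real.exp_le_exp.2 ?_) hμ0.le) hμk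
      have := mul_le_mul_of_nonneg_right (le_abs_self C1) (sq_nonneg lam)
      linarith only [this]
    have hμk2 : μ0 / 2 ≤ μk := half_le_of_exp_lower hy hμ0.le hμk'
    have hμkpos : 0 < μk := by linarith only [hμk2, hμ0]
    -- `y = C λ²`, `y ≤ 1`, `κ ≤ y/48`
    set y : ℝ := C * lam ^ 2 with hydef
    have hy0 : 0 ≤ y := by positivity
    have hlamC : lam ≤ 1 / (C + 1) := hlamτ.trans hτC
    have hy1 : y ≤ 1 := by
      rw [hydef]
      have h1 : C * lam ≤ 1 := by
        have h2 : C * lam ≤ C * (1 / (C + 1)) := mul_le_mul_of_nonneg_left hlamC hC0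
        have h3 : C * (1 / (C + 1)) ≤ 1 := by rw [mul_one_div, div_le_one (by linarith only [hC0])]; linarith only [hC0]
        exact h2.trans h3
      nlinarith only [h1, hlam0, hlam1, hC0]
    have hκ0 := K.hκ β
    have hκy : K.κ β ≤ y / 48 := by
      rw [hydef]
      have : aκ * lam ^ 2 ≤ C / 48 * lam ^ 2 := mul_le_mul_of_nonneg_right (by linarith only [hCκ]) (sq_nonneg lam)
      linarith only [hκs, this]
    have hκ1 : K.κ β < 1 := by linarith only [hκy, hy1]
    have hκ1' : K.κ β ≤ 1 := hκ1.le
    set w : GaugeConfig 3 L SU2 → ℝ := softWeight (χ β) with hwdef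
    obtain ⟨Cw, hCw⟩ := K.hwb β
    obtain ⟨hc0, hcχ⟩ := K.hc β
    -- fibre mass lower bound (for the projection)
    have hZ₀ : 0 < K.γ β * (1 - K.κ β) := mul_pos (K.hγ β) (by linarith)
    have hZ : ∀ u ∈ K.𝒰 β, K.γ β * (1 - K.κ β) ≤ fibreMassAd L w (K.Ω β) u := fun u hu => by
      have := (abs_le.mp (hN u hu)).1; linarith only [this]
    refine ⟨K.σ β, K.b β, K.hσ β, K.hb β, ?_, ?_, ?_⟩
    · -- b² ≤ C λ² θ / 16
      have h' : ab * lam ^ 2 ≤ C * lam ^ 2 * K.θ₀ / 16 := by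
        have h1 : ab ≤ C * K.θ₀ / 16 := by
          have := (div_le_iff₀ hθ0).mp (show 16 * ab / K.θ₀ ≤ C from hCb)
          linarith only [this]
        have := mul_le_mul_of_nonneg_right h1 (sq_nonneg lam)
        linarith only [this]
      exact hbs.trans h'
    · -- FLOOR (unchanged from p657088)
      obtain ⟨φ₀, hφm, ⟨C₀, hC₀⟩, hφg, hφs, hφpos, hφtop⟩ := hTop
      have hTφ := hT φ₀ hφm ⟨C₀, hC₀⟩ hφg hφs
      have hTlow : K.σ β * K.γ β * (1 - K.κ β) * qform su2Rep B (fun u => φ₀ u * K.W β u) (fun u => φ₀ u * K.W β u) -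
          K.κ β * K.σ β * K.γ β * μ0 * l2 φ₀ φ₀ ≤ tubeForm β (boFunAd L φ₀ (K.Ω β)) := by
        have := (abs_le.mp hTφ).1; linarith only [this]
      have hφtop' : Real.exp (-(C * lam / 16 * bareLambda B)) * μ0 * l2 φ₀ φ₀ ≤ qform su2Rep B (fun u => φ₀ u * K.W β u) (fun u => φ₀ u * K.W β u) := by
        refine le_trans (mul_le_mul_of_nonneg_right (mul_le_mul_of_nonneg_right (Real.exp_le_exp.mpr ?_) hμ0.le) (l2_self_nonneg_lat _)) hφtop
        rw [← hlamdef]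
        have := mul_le_mul_of_nonneg_right hC'' (sq_nonneg lam)
        nlinarith only [this]
      have hcB : 28 * crossBound L β K.m ≤ C * lam / 16 * lam * levelValue su2Rep L β 0 := by
        have h1 := (hcross β hβc).trans (mul_le_mul_of_nonneg_left (levelValue_zero_ge_uniform hβ1) (by positivity))
        rw [← hBdef, ← hlamdef] at h1
        have h2 : 1 * lam ^ 2 * levelValue su2Rep L β 0 ≤ C * lam / 16 * lam * levelValue su2Rep L β 0 := by
          refine mul_le_mul_of_nonneg_right ?_ (levelValue_su2Rep_pos (L := L) hβ0 0).le
          nlinarith only [hC16, sq_nonneg lam]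
        exact h1.trans h2
      have harith : Real.exp (-(C * lam / 4 * lam)) * ((1 + C * lam / 16 * lam / 4) * (1 + K.κ β)) ≤
          (1 - K.κ β) * Real.exp (-(C * lam / 16 * lam)) - K.κ β := by
        have h := arith_floor hy0 hy1 hκ0 hκy
        have e1 : C * lam / 4 * lam = y / 4 := by rw [hydef]; ring
        have e2 : C * lam / 16 * lam / 4 = y / 64 := by rw [hydef]; ring
        have e3 : C * lam / 16 * lam = y / 16 := by rw [hydef]; ring
        rw [e1, e2, e3]; exact h
      have hfl := floor_rate_clause_of_bricks hβ0.le (K.hχm β) (K.hχ1 β) (K.hχ0 β) hc0 hcχ (K.hwm β) hCw (K.hΩm β) (K.hΩ1 β) K.hm hδ₂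
        (fun φ U hφ hU => hbo φ U hφ hU) (K.hσ β).le (K.hγ β) hκ0 hκ1' hN hφm hC₀ hφs hφpos hφtop' hTlow hcB (by positivity) hμ0.le harith
      have e : C * lam / 4 * lam = C * lam ^ 2 / 4 := by ring
      rw [e] at hfl
      exact hfl
    · -- the split for an admissible family
      intro f hfm hfb hfs hfS hGram
      set u : Fin (k + 1) → GaugeConfig 3 L SU2 → ℝ := fun i => boProjAd L w (K.Ω β) (K.𝒰 β) (f i) with hudef
      set v : Fin (k + 1) → GaugeConfig 3 L SU2 → ℝ := fun i => fun U => f i U - u i U with hvdef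
      -- the colour-averaged slow coefficients `G i` and the potential `P`
      set G : Fin (k + 1) → GaugeConfig 3 1 SU2 → ℝ := fun i => colourAvg (L := 1) (boCoeffAd L w (K.Ω β) (K.𝒰 β) (f i)) with hGdef
      set D : GaugeConfig 3 1 SU2 → ℝ := fun u' => if orbitDist u' < K.δ₁ β then orbitDist u' ^ 2 else 0 with hDdef
      have hD0 : ∀ u', 0 ≤ D u' := fun u' => by simp only [hDdef]; split_ifs <;> positivity
      set P : (Fin (k + 1) → ℝ) → ℝ := fun a => K.κb * K.γ β * ∫ u', D u' * (∑ i, a i * G i u') ^ 2 ∂configMeasure SU2 1 with hPdef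
      have hP0 : ∀ a, 0 ≤ P a := fun a => mul_nonneg (mul_nonneg K.hκb (K.hγ β).le) (integral_nonneg fun u' => mul_nonneg (hD0 u') (sq_nonneg _))
      choose Cf hCf using hfb
      -- combinations
      have hfam : ∀ a : Fin (k + 1) → ℝ, Measurable (fun U => ∑ i, a i * f i U) := fun a => Finset.measurable_sum _ fun i _ => (hfm i).const_mul _
      have hfab : ∀ a : Fin (k + 1) → ℝ, ∀ U, |∑ i, a i * f i U| ≤ ∑ i, |a i| * Cf i := fun a U =>
        (Finset.abs_sum_le_sum_abs _ _).trans (Finset.sum_le_sum fun i _ => by rw [abs_mul]; exact mul_le_mul_of_nonneg_left (hCf i U) (abs_nonneg _))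
      have hfas : ∀ (a : Fin (k + 1) → ℝ) U, (∑ i, a i * f i U) ≠ 0 → χ β U ≠ 0 := fun a U hU => by
        obtain ⟨i, hi⟩ := exists_ne_zero_of_combination_ne_zero hU; exact hfs i U hi
      have hfash : ∀ (a : Fin (k + 1) → ℝ) U, (∑ i, a i * f i U) ≠ 0 → slowMean L U ∈ K.𝒰 β := fun a U hU => by
        obtain ⟨i, hi⟩ := exists_ne_zero_of_combination_ne_zero hU; exact hshadow U (hfs i U hi) (hfS i U hi)
      have hua : ∀ a : Fin (k + 1) → ℝ, (fun U => ∑ i, a i * u i U) = boProjAd L w (K.Ω β) (K.𝒰 β) (fun U => ∑ i, a i * f i U) := fun a => by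
        funext U; exact (boProjAd_sum (K.hwm β) hCw (K.hΩm β) (K.hΩ1 β) (K.𝒰 β) a hfm (fun i => ⟨Cf i, hCf i⟩) U).symm
      have hva : ∀ a : Fin (k + 1) → ℝ, (fun U => ∑ i, a i * v i U) = fun U => (∑ i, a i * f i U) - boProjAd L w (K.Ω β) (K.𝒰 β) (fun U => ∑ i, a i * f i U) U := fun a => by
        funext U
        rw [← congrFun (hua a) U]
        simp only [hvdef, mul_sub, Finset.sum_sub_distrib]
      -- the slow coefficient `φ_a` of the combination, and its colour average `G_a`
      have hφam : ∀ a : Fin (k + 1) → ℝ, Measurable (boCoeffAd L w (K.Ω β) (K.𝒰 β) (fun U => ∑ i, a i * f i U)) := fun a =>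
        measurable_boCoeffAd (K.hwm β) (K.hΩm β) (K.h𝒰m β) (hfam a)
      have hφab : ∀ a : Fin (k + 1) → ℝ, ∀ u', |boCoeffAd L w (K.Ω β) (K.𝒰 β) (fun U => ∑ i, a i * f i U) u'| ≤
          (∑ i, |a i| * Cf i) * 1 * Cw * (orthoTransverse L).real Set.univ / (K.γ β * (1 - K.κ β)) := fun a => abs_boCoeffAd_le hCw (K.hΩ1 β) hZ₀ hZ (hfab a)
      have hφas : ∀ (a : Fin (k + 1) → ℝ) u', boCoeffAd L w (K.Ω β) (K.𝒰 β) (fun U => ∑ i, a i * f i U) u' ≠ 0 → u' ∈ K.𝒰 β := fun a u' hu => by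
        by_contra hnu; exact hu (show boCoeffAd L w (K.Ω β) (K.𝒰 β) _ u' = 0 by unfold boCoeffAd; rw [Set.indicator_of_notMem hnu])
      have hGa : ∀ a : Fin (k + 1) → ℝ, colourAvg (L := 1) (boCoeffAd L w (K.Ω β) (K.𝒰 β) (fun U => ∑ i, a i * f i U)) = fun u' => ∑ i, a i * G i u' := fun a => by
        funext u'
        have e1 : boCoeffAd L w (K.Ω β) (K.𝒰 β) (fun U => ∑ i, a i * f i U) = fun u'' => ∑ i, a i * boCoeffAd L w (K.Ω β) (K.𝒰 β) (f i) u'' :=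
          funext fun u'' => boCoeffAd_sum (K.hwm β) hCw (K.hΩm β) (K.hΩ1 β) (K.𝒰 β) a hfm (fun i => ⟨Cf i, hCf i⟩) u''
        rw [e1]
        exact colourAvg_sum a (fun i => measurable_boCoeffAd (K.hwm β) (K.hΩm β) (K.h𝒰m β) (hfm i))
          (fun i => ⟨_, abs_boCoeffAd_le hCw (K.hΩ1 β) hZ₀ hZ (hCf i)⟩) u'
      have hGam : ∀ a : Fin (k + 1) → ℝ, Measurable (fun u' => ∑ i, a i * G i u') := fun a => by rw [← hGa a]; exact measurable_colourAvg (hφam a)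
      have hGab : ∀ a : Fin (k + 1) → ℝ, ∀ u', |∑ i, a i * G i u'| ≤ (∑ i, |a i| * Cf i) * 1 * Cw * (orthoTransverse L).real Set.univ / (K.γ β * (1 - K.κ β)) := fun a u' => by
        rw [← congrFun (hGa a) u']; exact abs_colourAvg_le (hφam a) (hφab a) u'
      have hGag : ∀ (a : Fin (k + 1) → ℝ) (g : Site 3 1 → SU2) (u' : GaugeConfig 3 1 SU2), (∑ i, a i * G i (gaugeTransform g u')) = ∑ i, a i * G i u' := fun a g u' => by
        rw [← congrFun (hGa a) (gaugeTransform g u'), ← congrFun (hGa a) u']; exact colourAvg_one_site_gaugeInvariant _ g u'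
      have hGas : ∀ (a : Fin (k + 1) → ℝ) u', (∑ i, a i * G i u') ≠ 0 → u' ∈ K.𝒰 β := fun a u' hu => by
        rw [← congrFun (hGa a) u'] at hu
        by_contra hnu
        exact hu (colourAvg_eq_zero_of_support (S := K.𝒰 β) (fun c v' => K.h𝒰inv β c v') (fun v' hv' => by by_contra h; exact hv' (hφas a v' h)) hnu)
      -- the projection of `f_a`: measurable, bounded
      have hPm : ∀ a : Fin (k + 1) → ℝ, Measurable (boProjAd L w (K.Ω β) (K.𝒰 β) (fun U => ∑ i, a i * f i U)) := fun a =>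
        measurable_boFunAd L (hφam a) (K.hΩm β)
      have hPb : ∀ a : Fin (k + 1) → ℝ, ∀ U, |boProjAd L w (K.Ω β) (K.𝒰 β) (fun U => ∑ i, a i * f i U) U| ≤
          (∑ i, |a i| * Cf i) * 1 * Cw * (orthoTransverse L).real Set.univ / (K.γ β * (1 - K.κ β)) * 1 := fun a =>
        abs_boFunAd_le L (hφab a) (K.hΩ1 β)
      have hrem := fun a : Fin (k + 1) → ℝ => remainder_propsAd (K.hwm β) hCw (K.hΩm β) (K.hΩ1 β) (K.h𝒰m β) hZ₀ hZ (fun φ U hφ hU => (hbo φ U hφ hU).1)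
        (hfam a) (hfab a) (hfas a) (hfash a)
      have hvm : ∀ a : Fin (k + 1) → ℝ, Measurable (fun U => (∑ i, a i * f i U) - boProjAd L w (K.Ω β) (K.𝒰 β) (fun U => ∑ i, a i * f i U) U) := fun a =>
        (hfam a).sub (hPm a)
      have hvb : ∀ a : Fin (k + 1) → ℝ, ∀ U, |(∑ i, a i * f i U) - boProjAd L w (K.Ω β) (K.𝒰 β) (fun U => ∑ i, a i * f i U) U| ≤
          (∑ i, |a i| * Cf i) + (∑ i, |a i| * Cf i) * 1 * Cw * (orthoTransverse L).real Set.univ / (K.γ β * (1 - K.κ β)) * 1 := fun a U =>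
        (abs_sub _ _).trans (add_le_add (hfab a U) (hPb a U))
      refine ⟨u, v, P, fun a => ⟨hP0 a, ?_, ?_, ?_, ?_, ?_⟩, ?_⟩
      · exact integral_nonneg fun U => mul_nonneg (sq_nonneg _) (K.hw0 β U)
      · exact integral_nonneg fun U => mul_nonneg (sq_nonneg _) (K.hw0 β U)
      · -- MASS (exact)
        rw [hua a, hva a]
        exact le_of_eq (tubeNormSq_boProjAd_add (K.hwm β) hCw (K.hΩm β) (K.hΩ1 β) (K.h𝒰m β) hZ₀ hZ (hfam a) (hfab a))
      · -- STIFF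
        rw [hva a]
        exact hST _ (hvm a) ⟨_, hvb a⟩ (hrem a).1 (hrem a).2
      · -- OFFDIAG with potential: run the cross terms through the colour average of the slow coefficient
        have hum' : Measurable (fun U => ∑ i, a i * u i U) := by rw [hua a]; exact hPm a
        have hub' : ∀ U, |∑ i, a i * u i U| ≤ (∑ i, |a i| * Cf i) * 1 * Cw * (orthoTransverse L).real Set.univ / (K.γ β * (1 - K.κ β)) * 1 := fun U => by
          have e := congrFun (hua a) U; rw [e]; exact hPb a U
        have hvm' : Measurable (fun U => ∑ i, a i * v i U) := by rw [hva a]; exact hvm a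
        have hvb' : ∀ U, |∑ i, a i * v i U| ≤ (∑ i, |a i| * Cf i) + (∑ i, |a i| * Cf i) * 1 * Cw * (orthoTransverse L).real Set.univ / (K.γ β * (1 - K.κ β)) * 1 :=
          fun U => by have e := congrFun (hva a) U; rw [e]; exact hvb a U
        have hvs' : ∀ U, (∑ i, a i * v i U) ≠ 0 → χ β U ≠ 0 := fun U hU => by
          have e := congrFun (hva a) U; rw [e] at hU; exact (hrem a).1 U hU
        have hvo' : ∀ u', fibreInnerAd L w (K.Ω β) (fun U => ∑ i, a i * v i U) u' = 0 := fun u' => by rw [hva a]; exact (hrem a).2 u'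
        have hsplit : (fun U => ∑ i, a i * f i U) = fun U => (∑ i, a i * u i U) + (∑ i, a i * v i U) := by
          funext U; rw [← Finset.sum_add_distrib]; exact Finset.sum_congr rfl fun i _ => by simp only [hvdef]; ring
        rw [hsplit, tubeForm_add β hum' hub' hvm' hvb']
        -- `u_a = boFunAd φ_a Ω` and its colour average `boFunAd G_a Ω`
        have e1 : (fun U => ∑ i, a i * u i U) = boFunAd L (boCoeffAd L w (K.Ω β) (K.𝒰 β) (fun U => ∑ i, a i * f i U)) (K.Ω β) := hua a
        have hcA : colourAvg (boFunAd L (boCoeffAd L w (K.Ω β) (K.𝒰 β) (fun U => ∑ i, a i * f i U)) (K.Ω β)) = boFunAd L (fun u' => ∑ i, a i * G i u') (K.Ω β) := by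
          funext U; rw [colourAvg_boFunAd L _ (K.hΩinv β) U, hGa a]
        have hGuM : Measurable (boFunAd L (fun u' => ∑ i, a i * G i u') (K.Ω β)) := measurable_boFunAd L (hGam a) (K.hΩm β)
        have hGub := abs_boFunAd_le L (hGab a) (K.hΩ1 β)
        -- cross terms are blind to the colour average
        have hX1 : tubeCross β (fun U => ∑ i, a i * u i U) (fun U => ∑ i, a i * v i U) = tubeCross β (boFunAd L (fun u' => ∑ i, a i * G i u') (K.Ω β)) (fun U => ∑ i, a i * v i U) := by
          rw [← hcA, tubeCross_colourAvg_left β (by rw [← e1]; exact hum') (by rw [← e1]; exact hub') hvm' hvb', ← e1]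
        have hX2 : tubeCross β (fun U => ∑ i, a i * v i U) (fun U => ∑ i, a i * u i U) = tubeCross β (fun U => ∑ i, a i * v i U) (boFunAd L (fun u' => ∑ i, a i * G i u') (K.Ω β)) := by
          rw [← hcA, tubeCross_colourAvg_right β (by rw [← e1]; exact hum') (by rw [← e1]; exact hub'), ← e1]
        -- the potential brick on `G_a`
        obtain ⟨h1, h2⟩ := hOD (fun u' => ∑ i, a i * G i u') (fun U => ∑ i, a i * v i U) (hGam a) ⟨_, hGab a⟩ (hGag a) (hGas a) hvm' ⟨_, hvb'⟩ hvs' hvo'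
        -- the colour average does not increase the weighted norm: `‖boFunAd G_a Ω‖² ≤ ‖u_a‖²`
        have hNle : tubeNormSq w (boFunAd L (fun u' => ∑ i, a i * G i u') (K.Ω β)) ≤ tubeNormSq w (fun U => ∑ i, a i * u i U) := by
          rw [← hcA, e1]
          exact tubeNormSq_colourAvg_le (K.hwm β) hCw (K.hw0 β) (K.hwinv β) (by rw [← e1]; exact hum') (by rw [← e1]; exact hub')
        have hNG0 : 0 ≤ tubeNormSq w (boFunAd L (fun u' => ∑ i, a i * G i u') (K.Ω β)) := integral_nonneg fun U => mul_nonneg (sq_nonneg _) (K.hw0 β U)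
        have hsqrt : Real.sqrt (K.b β ^ 2 * tubeNormSq w (boFunAd L (fun u' => ∑ i, a i * G i u') (K.Ω β)) + K.κb * K.γ β * ∫ u', D u' * (∑ i, a i * G i u') ^ 2 ∂configMeasure SU2 1) ≤
            Real.sqrt (K.b β ^ 2 * tubeNormSq w (fun U => ∑ i, a i * u i U) + P a) := by
          refine Real.sqrt_le_sqrt ?_
          have := mul_le_mul_of_nonneg_left hNle (sq_nonneg (K.b β))
          rw [hPdef]; linarith
        have hσμ0 : 0 ≤ K.σ β * μ0 := mul_nonneg (K.hσ β).le hμ0.le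
        have hsv0 : 0 ≤ Real.sqrt (tubeNormSq w (fun U => ∑ i, a i * v i U)) := Real.sqrt_nonneg _
        rw [hX1, hX2]
        have h1' := (abs_le.mp h1).2
        have h2' := (abs_le.mp h2).2
        have hmono : (K.σ β * μ0) * Real.sqrt (K.b β ^ 2 * tubeNormSq w (boFunAd L (fun u' => ∑ i, a i * G i u') (K.Ω β)) +
              K.κb * K.γ β * ∫ u', D u' * (∑ i, a i * G i u') ^ 2 ∂configMeasure SU2 1) * Real.sqrt (tubeNormSq w (fun U => ∑ i, a i * v i U)) ≤
            (K.σ β * μ0) * Real.sqrt (K.b β ^ 2 * tubeNormSq w (fun U => ∑ i, a i * u i U) + P a) * Real.sqrt (tubeNormSq w (fun U => ∑ i, a i * v i U)) :=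
          mul_le_mul_of_nonneg_right (mul_le_mul_of_nonneg_left hsqrt hσμ0) hsv0
        linarith [h1', h2', hmono]
      · -- SLOW′ (dressed one-site form WITH POTENTIAL; one-site inner RATE)
        have hTup : ∀ φ : GaugeConfig 3 1 SU2 → ℝ, Measurable φ → (∃ C : ℝ, ∀ u, |φ u| ≤ C) →
            (∀ (g : Site 3 1 → SU2) (u : GaugeConfig 3 1 SU2), φ (gaugeTransform g u) = φ u) → (∀ u, φ u ≠ 0 → u ∈ K.𝒰 β) →
            tubeForm β (boFunAd L φ (K.Ω β)) ≤ K.σ β * K.γ β * (1 + K.κ β) * qform su2Rep ((L : ℝ) ^ 3 * β) (fun u => φ u * K.W β u) (fun u => φ u * K.W β u) +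
              K.κ β * K.σ β * K.γ β * levelValue su2Rep 1 ((L : ℝ) ^ 3 * β) 0 * l2 φ φ :=
          fun φ h1 h2 h3 h4 => by have := (abs_le.mp (hT φ h1 h2 h3 h4)).2; linarith only [this]
        have hDOS : ∀ G' : Fin (k + 1) → (GaugeConfig 3 1 SU2 → ℝ), (∀ i, Measurable (G' i)) → (∀ i, ∃ C : ℝ, ∀ U, |G' i U| ≤ C) →
            (∀ i (g : Site 3 1 → SU2) (U : GaugeConfig 3 1 SU2), G' i (gaugeTransform g U) = G' i U) → (∀ i U, G' i U ≠ 0 → orbitDist U < K.δ₁ β) →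
              ∃ a : Fin (k + 1) → ℝ, a ≠ 0 ∧
                (qform su2Rep ((L : ℝ) ^ 3 * β) (fun U => (∑ i, a i * G' i U) * K.W β U) (fun U => (∑ i, a i * G' i U) * K.W β U) +
                    4 * K.κb / K.θ₀ * levelValue su2Rep 1 ((L : ℝ) ^ 3 * β) 0 *
                      ∫ U, (if orbitDist U < K.δ₁ β then orbitDist U ^ 2 else 0) * (∑ i, a i * G' i U) ^ 2 ∂configMeasure SU2 1) *
                    levelValue su2Rep 1 ((L : ℝ) ^ 3 * β) 0 ≤
                  Real.exp (C * lam / 8 * bareLambda ((L : ℝ) ^ 3 * β)) * levelValue su2Rep 1 ((L : ℝ) ^ 3 * β) k * levelValue su2Rep 1 ((L : ℝ) ^ 3 * β) 0 *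
                    l2 (fun U => ∑ i, a i * G' i U) (fun U => ∑ i, a i * G' i U) := by
          intro G' h1 h2 h3 h4
          obtain ⟨a, ha, h⟩ := hDS G' h1 h2 h3 h4
          refine ⟨a, ha, h.trans ?_⟩
          rw [← hBdef, ← hlamdef, ← hμ0def, ← hμkdef]
          refine mul_le_mul_of_nonneg_right (mul_le_mul_of_nonneg_right (mul_le_mul_of_nonneg_right (Real.exp_le_exp.mpr ?_) hμkpos.le) hμ0.le)
            (l2_self_nonneg_lat _)
          have h6 : COS * lam ^ 2 ≤ |COS| * lam ^ 2 := mul_le_mul_of_nonneg_right (le_abs_self _) (sq_nonneg lam)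
          have h7 : |COS| * lam ^ 2 ≤ C / 8 * lam ^ 2 := mul_le_mul_of_nonneg_right (by linarith only [hCOS]) (sq_nonneg lam)
          nlinarith only [h6, h7]
        have harith : (1 + K.κ β) * Real.exp (C * lam / 8 * lam) * μk + K.κ β * μ0 ≤ (1 - K.κ β) * Real.exp (C * lam / 4 * lam) * μk := by
          have h := arith_slow hy0 hy1 hκ0 hκy hμ0.le hμk2
          have e1 : C * lam / 8 * lam = y / 8 := by rw [hydef]; ring
          have e2 : C * lam / 4 * lam = y / 4 := by rw [hydef]; ring
          rw [e1, e2]; exact h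
        obtain ⟨a, ha, hslow⟩ := slow_rate_clause_of_dressed_pot (k := k) (ε := C * lam) (ε' := C * lam / 8) (K.hwm β) hCw (K.hw0 β) (K.hwinv β) (K.hΩm β) (K.hΩ1 β) (K.hΩinv β)
          (W := K.W β) (K.h𝒰m β) (K.h𝒰inv β) (K.h𝒰δ₁ β) (K.hσ β).le (K.hγ β) hκ0 hκ1 hκE hN hTup hDOS hμ0 hμkpos.le harith hfm (fun i => ⟨Cf i, hCf i⟩)
        refine ⟨a, ha, ?_⟩
        have e : C * lam / 4 * lam = C * lam ^ 2 / 4 := by ring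
        rw [e] at hslow
        have eP : 4 / K.θ₀ * (K.σ β * levelValue su2Rep 1 ((L : ℝ) ^ 3 * β) 0) * P a =
            4 * K.κb / K.θ₀ * (K.σ β * levelValue su2Rep 1 ((L : ℝ) ^ 3 * β) 0) *
              (K.γ β * ∫ u', (if orbitDist u' < K.δ₁ β then orbitDist u' ^ 2 else 0) * (∑ i, a i * colourAvg (L := 1) (boCoeffAd L w (K.Ω β) (K.𝒰 β) (f i)) u') ^ 2 ∂configMeasure SU2 1) := by
          rw [hPdef]; ring
        rw [eP]
        exact hslow
  obtain ⟨β₀, hβ₀⟩ := Filter.eventually_atTop.mp hev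
  exact ⟨β₀, fun β hβ => hβ₀ β hβ⟩

/-! ## §2 ★★★ The CORE RATE of «ratepack-v3», and K1 -/

/-- ★★★ **CORE RATE at every level from the v3 bricks + (EM)** for the record core weight `recordChi L (1/6) 43 M` (`M ≥ 2`), test support `{orbitDist < β^{−1/6}}`.
[cite: Luscher1983, §3] -/
theorem coreRatePot_of_bricksPot (hEM : OneSiteEigenMoments) {M : ℝ} (hM : 2 ≤ M) (K : BORateBricksPot L (recordChi L (1 / 6) 43 M) (powScale (1 / 6))) (k : ℕ) :
    ∃ C βI : ℝ, ∀ β : ℝ, βI ≤ β →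
      ∀ F : Fin (k + 1) → (GaugeConfig 3 L SU2 → ℝ), (∀ i, IsPhys (F i)) →
        (∀ i U, F i U ≠ 0 → ∃ z : Fin 3 → Bool, orbitDist (TT.twist3 z U) < powScale (1 / 6) β) →
        (∀ a : Fin (k + 1) → ℝ, a ≠ 0 → 0 < l2 (fun U => ∑ i, a i * F i U) (fun U => ∑ i, a i * F i U)) →
          ∃ a : Fin (k + 1) → ℝ, a ≠ 0 ∧
            qform su2Rep β (fun U => ∑ i, a i * F i U) (fun U => ∑ i, a i * F i U) * levelValue su2Rep 1 ((L : ℝ) ^ 3 * β) 0 ≤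
              Real.exp (C * bareLambda ((L : ℝ) ^ 3 * β) ^ 2) * levelValue su2Rep 1 ((L : ℝ) ^ 3 * β) k *
                levelValue su2Rep L β 0 * l2 (fun U => ∑ i, a i * F i U) (fun U => ∑ i, a i * F i U) :=
  innerRateAt_of_ratePackagePot (L := L) k (fun β => powScale_pos (1 / 6) β) powScale_sixth_eventually_le
    (softTubeAdmissible_recordChi' (1 / 6) 43 M (by norm_num) hM) (softTubeBORatePackagePotOn_of_bricksPot hEM K)

/-- ★★★★ **K1 `NearFlatRatioLaw` ⟸ (EM) + v3 bricks on the `β^{-1/6}` core for every `L ≥ 2` + lane A's SHELL** (`nearFlatRatioLaw_of_coreRate_shell_pow`, core rate at `k = 1`).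
[cite: Luscher1983, §3] -/
theorem nearFlatRatioLaw_of_bricksPot_shell (hEM : OneSiteEigenMoments) {M : ℝ} (hM : 2 ≤ M)
    (K : ∀ (L : ℕ) [NeZero L], 2 ≤ L → BORateBricksPot L (recordChi L (1 / 6) 43 M) (powScale (1 / 6)))
    (hshell : ∀ (L : ℕ) [NeZero L], 2 ≤ L → InnerShellGainAt L (powScale (1 / 6)) (powScale (1 / 40))) :
    Summit.QuantumFields.YangMills.Theses.FlatTubeReduction.NearFlatRatioLaw :=
  nearFlatRatioLaw_of_coreRate_shell_pow (fun L _ hL => coreRatePot_of_bricksPot hEM hM (K L hL) 1) hshell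

end Summit.QuantumFields.YangMills.Theorems.FemtoTransferGap.RateTube

end
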